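import Summits.BirchSwinnertonDyer.BirchSwinnertonDyer.Theorems.KatoDescentPotSupersingularH1TateTorsion
import Summits.BirchSwinnertonDyer.BirchSwinnertonDyer.Theorems.KatoDescentPotSupersingularKatoSelmerSharpBoundKato
import Summits.BirchSwinnertonDyer.BirchSwinnertonDyer.Theorems.KatoDescentPotSupersingularKatoFiniteLevelStrictCompactKernel
import Summits.BirchSwinnertonDyer.BirchSwinnertonDyer.Theorems.KatoDescentPotSupersingularSelmerMulKKummer
import Summits.BirchSwinnertonDyer.BirchSwinnertonDyer.Theorems.ThetaPartnerAtTwoSignedControlAtTwoCasselsBockstein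
import HarnessLib

/-!
# Torsion classes of `H¹(ℚ, T_pW)` reduce to KUMMER classes: `red_{p^k}(H¹(ℚ,T_pW)_tors) ⊆ Sel^{(p^k)}(W/ℚ) ∩ ker (H¹(ℚ,W[p^k]) → H¹(ℚ,W))`,
# injectively once `p^k > #W(ℚ)_tors` (the factor `#H¹(ℤ[1/p],T)_tors` of Kato's (14.9.3)/(C2) enters crux M's ledger through this map)
# (route `KatoDescentPotSupersingular` / `…Tame…`, crux M = stmt-BirchSwinnertonDyer-19196, U₀-red 19190/19203; route-free helper)

Seat `bsd-potss-rkm` g24 (prover; cell `bsd-potss`), TARGET R283 / wake W-M6 (`--supports …`; closes nothing).  HONEST FRAMING: BSD is not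
proved by any of this; nothing is booked; theorems only (no definition, no named fact): TOOL theorems of Galois cohomology of elliptic curves.

## Why

The level-0 ledger of crux M (parts 33–58, seat rkm g17–g21) proves Kato's Prop. 14.16 (2) count with the torsion slack `2·ord_p #W(ℚ)_tors`
(`…ASideCountPPart`), one `ord_p #W(ℚ)_tors` more than Kato's EXACT count at the member (`MemberCountInputs.exactCount`, `2t` after (c2′)).  The
slack sits in the Poitou–Tate companion (ii) (`…KatoSelmerPTCokernel`): the cokernel of `S → ⊕_{ℓ≠p} H¹_ur(ℚ_ℓ,W[p^∞])` is bounded there by the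
order of the Kummer image `G₀ = κ_{p^k}(W(ℚ))`, whereas in print (Kato p. 244, Greenberg LNM 1716 app. §4, Cassels) it is `#G₀ / #H¹_f(ℤ[1/p],T)`.
The missing factor is carried by the TORSION classes of `A = H¹(ℤ[1/p], T_pW)`: this file shows that their reductions mod `p^k` ARE Kummer classes
of rational points (so they lie in `G₀`), injectively for `p^k > #W(ℚ)_tors`.

## What (cocycles; `W/ℚ` elliptic, `p` prime, `red_{p^k} : H¹(⊤, T_pW) → H¹(⊤, W[(p:ℤ)^k])` Kato's reduction, `ι′ : W[(p:ℤ)^k] ⥲ W[((p^k:ℕ):ℤ)]`)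

* `torsionH1ToH1_map_torsionInclusion_reduceH1Pk_eq_zero` — if `p^N · c = 0` in `H¹(ℚ, T_pW)` then `(W[p^k] ↪ W)_* (ι′_* red_{p^k} c) = 0` in
  `H¹(ℚ, W)`: with the Bockstein witness `m ∈ T_pW`, `p^N φ(g) = g m − m` (part 48 `exists_bockstein_of_pow_smul_eq_zero`), the reduced cocycle is
  `g ↦ (φ g)_k = p^N (φ g)_{N+k} = g m_{N+k} − m_{N+k}`, the coboundary of the POINT `m_{N+k} ∈ W[p^{N+k}] ⊆ W(ℚ̄)`;
* `map_torsionInclusion_reduceH1Pk_mem_selmerGroup_inf_ker` — hence `ι′_* red_{p^k} c ∈ Sel^{(p^k)}(W/ℚ) ⊓ ker (W[p^k] ↪ W)_*` (the local Selmer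
  kernels are the preimages of the local restriction kernels of `H¹(ℚ,W)`, `selmerLocalKer_eq_comap`);
* `eq_zero_of_map_torsionInclusion_reduceH1Pk_eq_zero` — if moreover `W(ℚ)` is finite and `#W(ℚ)_tors < p^k`, then `ι′_* red_{p^k} c = 0` forces
  `c = 0` (`ker red_{p^k} = p^k H¹`, part 18; a `p^k`-th root `c'` of `c` is torsion, and every cyclic torsion subgroup of `H¹(ℚ,T_pW)` has order
  `≤ #W(ℚ)[p^·] ≤ #W(ℚ)_tors < p^k`, part 48 `natCard_torsionBy_H1_top_le_natCard_torsionBy_point`);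
* `natCard_inf_torsionBy_le_natCard_map_inf` — so for every subgroup `A ≤ H¹(ℚ,T_pW)`:
  `#(A ⊓ H¹(ℚ,T_pW)[p^N]) ≤ #((ι′_* red_{p^k})(A ⊓ H¹(ℚ,T_pW)[p^N]))` and the image lies in `Sel^{(p^k)} ⊓ ker (W[p^k] ↪ W)_*`.

References: K. Kato, Astérisque 295 (2004), §13.8 (p. 228), proof of Prop. 14.16 (2) (p. 244: `H¹_f(ℤ[1/p],T)` = the torsion part) [Kato2004Asterisque];
R. Greenberg, LNM 1716 (1999), appendix to §4 [GreenbergLNM1716]; J. H. Silverman, *AEC* (2009), VIII §2 (Kummer sequence), X.4.2 [SilvermanAEC2009].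
-/

-- the summit and its single problem are both named `BirchSwinnertonDyer` (registry layout D-0017)
set_option linter.dupNamespace false
set_option autoImplicit false

noncomputable section

open scoped NumberField AddSubgroup Classical ContRepresentation
open Field CategoryTheory WeierstrassCurve
open Literature.NumberTheory.GaloisRepresentations Literature.NumberTheory.GaloisRepresentations.DiscreteGaloisModule
open Literature.NumberTheory.EllipticCurves Literature.NumberTheory.EllipticCurves.Kato2004
open Literature.NumberTheory.EllipticCurves.Kato2004.EulerSystemValues
open Summit.BirchSwinnertonDyer.BirchSwinnertonDyer.Theorems.KummerTowerOrthogonal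
open Summit.BirchSwinnertonDyer.BirchSwinnertonDyer.Theorems.KatoFiniteLevelCount

namespace Summit.BirchSwinnertonDyer.BirchSwinnertonDyer.Theorems.H1TateTorsion

section Kummer

variable {p : ℕ} [hp : Fact p.Prime] (W : WeierstrassCurve ℚ) [W.IsElliptic] [ContinuousSMul ℤ_[p] (W.tateModule p)] (k : ℕ)

/-- **Torsion classes of `H¹(ℚ, T_pW)` reduce to classes dying in `H¹(ℚ, W)`.**  If `p^N · c = 0` then the reduction `ι′_* red_{p^k} c ∈ H¹(ℚ, W[p^k])`
maps to `0` under `(W[p^k] ↪ W)_*`: with a Bockstein witness `m` (`p^N φ(g) = g m − m`) the reduced cocycle `g ↦ (φ g)_k = g·m_{N+k} − m_{N+k}` is the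
coboundary of the point `m_{N+k} ∈ W(ℚ̄)` (it is the Kummer cocycle of the rational point `m_N`).
[cite: Kato2004Asterisque, §13.8 (p. 228) and proof of Prop. 14.16 (2) (p. 244)] [cite: SilvermanAEC2009, VIII §2] -/
theorem torsionH1ToH1_map_torsionInclusion_reduceH1Pk_eq_zero (N : ℕ) (c : H1 (tateRep W p) ⊤)
    (hc : ((p : ℤ_[p]) ^ N) • c = 0) :
    torsionH1ToH1 W ((p ^ k : ℕ) : ℤ)
      (galoisCohomology.map (W.torsionInclusion (intPow_dvd_natCast_pow p k)) 1
        ((ofTopSubgroup (W.torsionGaloisModule ((p : ℤ) ^ k)).toTopRep 1).hom (reduceH1Pk W p k ⊤ c))) = 0 := by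
  obtain ⟨φ, rfl⟩ := oneCocycleClass_surjective _ c
  obtain ⟨m, hm, -⟩ := exists_bockstein_of_pow_smul_eq_zero W ⊤ N φ hc
  rw [reduceH1Pk_oneCocycleClass, ofTopSubgroup_hom_oneCocycleClass, galoisCohomology.map_one_oneCocycleClass,
    torsionH1ToH1_eq_resH1Hom]
  erw [resH1Hom_id_oneCocycleClass]
  rw [oneCocycleClass_eq_zero_iff]
  refine ⟨TateModule.proj p (N + k) m, fun g => ?_⟩
  change ((tateModPk W p k (φ.1 (toTopSubgroupHom g)) : geomTorsion W ((p : ℤ) ^ k)) : geomPoints W) =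
    g • TateModule.proj p (N + k) m - TateModule.proj p (N + k) m
  rw [coe_tateModPk_apply, ← TateModule.pow_smul_proj_self_add N k, ← map_nsmul, hm (toTopSubgroupHom g), map_sub,
    TateModule.proj_smul_of_distribMulAction]
  rfl

/-- **Torsion classes of `H¹(ℚ, T_pW)` reduce into `Sel^{(p^k)}(W/ℚ) ⊓ ker (W[p^k] ↪ W)_*`** (the Kummer image of `W(ℚ)/p^k`): the local Selmer
kernels are the preimages under `(W[p^k] ↪ W)_*` of the local restriction kernels of `H¹(ℚ, W)` (`selmerLocalKer_eq_comap`), and the class dies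
already in `H¹(ℚ, W)`. [cite: SilvermanAEC2009, VIII §2 and X.§4 (diagram (**))] [cite: Kato2004Asterisque, proof of Prop. 14.16 (2) (p. 244)] -/
theorem map_torsionInclusion_reduceH1Pk_mem_selmerGroup_inf_ker (N : ℕ) (c : H1 (tateRep W p) ⊤)
    (hc : ((p : ℤ_[p]) ^ N) • c = 0) :
    galoisCohomology.map (W.torsionInclusion (intPow_dvd_natCast_pow p k)) 1
        ((ofTopSubgroup (W.torsionGaloisModule ((p : ℤ) ^ k)).toTopRep 1).hom (reduceH1Pk W p k ⊤ c)) ∈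
      selmerGroup W ((p ^ k : ℕ) : ℤ) ⊓ (torsionH1ToH1 W ((p ^ k : ℕ) : ℤ)).ker := by
  have h0 := torsionH1ToH1_map_torsionInclusion_reduceH1Pk_eq_zero W k N c hc
  refine ⟨(mem_selmerGroup_iff W _ _).mpr ⟨fun v => ?_, fun w => ?_⟩, (AddMonoidHom.mem_ker).mpr h0⟩
  · rw [WeierstrassCurve.selmerLocalKer_eq_comap, AddSubgroup.mem_comap, h0]; exact zero_mem _
  · rw [WeierstrassCurve.selmerLocalKer_eq_comap, AddSubgroup.mem_comap, h0]; exact zero_mem _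

/-- `((p^N : ℕ) : ℤ) • c = 0` iff `(p : ℤ_p)^N • c = 0` on `H¹(⊤, T_pW)` (the two scalar actions agree on naturals). [folklore] -/
theorem pow_smul_eq_zero_of_natCast_zsmul_eq_zero (N : ℕ) (c : H1 (tateRep W p) ⊤) (hc : ((p ^ N : ℕ) : ℤ) • c = 0) :
    ((p : ℤ_[p]) ^ N) • c = 0 := by
  rw [← Nat.cast_pow, Nat.cast_smul_eq_nsmul]
  rwa [Nat.cast_smul_eq_nsmul] at hc

/-- **Injectivity of the reduction on torsion classes for `p^k > #W(ℚ)_tors`** (`W(ℚ)` finite): if `p^N · c = 0` and `ι′_* red_{p^k} c = 0` then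
`c = 0`.  Indeed `red_{p^k} c = 0` gives `c = p^k c'` (part 18, `ker red = p^k H¹`); `c'` is torsion, of `p`-power order `p^a` with
`p^a = #⟨c'⟩ ≤ #H¹(ℚ,T_pW)[p^a] ≤ #W(ℚ)[p^a] ≤ #W(ℚ)_tors < p^k` (part 48), so `a < k` and `c = p^{k−a}(p^a c') = 0`.
[cite: Kato2004Asterisque, §13.8 (p. 228)] [cite: SilvermanAEC2009, VIII §1] -/
theorem eq_zero_of_map_torsionInclusion_reduceH1Pk_eq_zero [Finite W.toAffine.Point] (hk : W.torsionOrder < p ^ k) (N : ℕ)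
    (c : H1 (tateRep W p) ⊤) (hc : ((p ^ N : ℕ) : ℤ) • c = 0)
    (h0 : galoisCohomology.map (W.torsionInclusion (intPow_dvd_natCast_pow p k)) 1
      ((ofTopSubgroup (W.torsionGaloisModule ((p : ℤ) ^ k)).toTopRep 1).hom (reduceH1Pk W p k ⊤ c)) = 0) : c = 0 := by
  have hpp : p.Prime := hp.out
  -- `ι′_*` is injective on classes (`W[((p^k:ℕ):ℤ)] / W[(p:ℤ)^k] = W[1] = 0`, Greenberg p. 121)
  have hinj : Function.Injective (galoisCohomology.map (W.torsionInclusion (intPow_dvd_natCast_pow p k)) 1) :=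
    SignedEC.CasselsPT.map_torsionInclusion_injective_of_forall_fixed_eq_zero_of_eq W (d := (p : ℤ) ^ k) (k := 1)
      (N := ((p ^ k : ℕ) : ℤ)) (pow_ne_zero _ (by exact_mod_cast hpp.ne_zero)) (by rw [mul_one, Nat.cast_pow])
      (fun P _ => Subtype.ext (by
        have h1 : (1 : ℤ) • (P : geomPoints W) = 0 := (Submodule.mem_torsionBy_iff (R := ℤ) _ _).mp P.2
        rwa [one_smul] at h1))
      (intPow_dvd_natCast_pow p k)
  have hred : (ofTopSubgroup (W.torsionGaloisModule ((p : ℤ) ^ k)).toTopRep 1).hom (reduceH1Pk W p k ⊤ c) = 0 :=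
    hinj (h0.trans (map_zero _).symm)
  -- `c = p^k • c'`
  obtain ⟨c', rfl⟩ := (ofTopSubgroup_reduceH1Pk_eq_zero_iff W p k c).mp hred
  -- `c'` is torsion: `p^{N+k} c' = 0`
  have hc' : ((p ^ (N + k) : ℕ) : ℤ) • c' = 0 := by
    rw [pow_add, Nat.cast_mul, mul_smul]
    have h1 : ((p ^ k : ℕ) : ℤ) • c' = ((p : ℤ_[p]) ^ k) • c' := by
      rw [← Nat.cast_pow, Nat.cast_smul_eq_nsmul, Nat.cast_smul_eq_nsmul]
    rw [h1]; exact hc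
  -- the cyclic subgroup generated by `c'` sits in `H¹[p^a]`, `p^a` its order, and has order `p^a ≤ #W(ℚ)[p^a] ≤ #W(ℚ)_tors < p^k`
  have hfin : IsOfFinAddOrder c' :=
    isOfFinAddOrder_iff_zsmul_eq_zero.mpr ⟨((p ^ (N + k) : ℕ) : ℤ), Int.natCast_ne_zero.mpr (pow_ne_zero _ hpp.ne_zero), hc'⟩
  have hns : (p ^ (N + k)) • c' = 0 := by have h := hc'; rwa [natCast_zsmul] at h
  obtain ⟨a, -, ha⟩ := (Nat.dvd_prime_pow hpp).mp (addOrderOf_dvd_iff_nsmul_eq_zero.mpr hns)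
  have hle : addOrderOf c' ≤ Nat.card ↥(W.toAffine.Point[((p ^ a : ℕ) : ℤ)]) := by
    -- `⟨c'⟩ ≤ H¹[p^a]` and `#H¹[p^a] ≤ #W(ℚ)[p^a]`
    haveI := finite_torsionBy_H1 W (p := p) ⊤ a
    have hsub : AddSubgroup.zmultiples c' ≤ (H1 (tateRep W p) ⊤)[((p ^ a : ℕ) : ℤ)] := by
      rw [AddSubgroup.zmultiples_le]
      refine AddSubgroup.torsionBy.nsmul_iff.mpr ?_
      rw [← ha]
      exact addOrderOf_nsmul_eq_zero c'
    calc addOrderOf c' = Nat.card (AddSubgroup.zmultiples c') := (Nat.card_zmultiples c').symm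
      _ ≤ Nat.card ↥((H1 (tateRep W p) ⊤)[((p ^ a : ℕ) : ℤ)]) := AddSubgroup.card_le_of_le hsub
      _ ≤ Nat.card ↥(W.toAffine.Point[((p ^ a : ℕ) : ℤ)]) := natCard_torsionBy_H1_top_le_natCard_torsionBy_point W a
  have htO : Nat.card (AddCommGroup.torsion W.toAffine.Point) = W.torsionOrder := by
    unfold WeierstrassCurve.torsionOrder; convert rfl
  have hdvd : Nat.card ↥(W.toAffine.Point[((p ^ a : ℕ) : ℤ)]) ∣ Nat.card (AddCommGroup.torsion W.toAffine.Point) :=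
    AddSubgroup.card_dvd_of_le fun x hx => by
      rw [AddCommGroup.mem_torsion, isOfFinAddOrder_iff_zsmul_eq_zero]
      exact ⟨_, Int.natCast_ne_zero.mpr (pow_ne_zero a hpp.ne_zero), (Submodule.mem_torsionBy_iff (R := ℤ) _ x).mp hx⟩
  rw [htO] at hdvd
  have hle' : addOrderOf c' ≤ W.torsionOrder := hle.trans (Nat.le_of_dvd W.torsionOrder_pos_holds hdvd)
  have hak : a < k := by
    by_contra h
    have h' : p ^ k ≤ p ^ a := Nat.pow_le_pow_right hpp.pos (not_lt.mp h)
    rw [← ha] at h'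
    exact lt_irrefl _ ((h'.trans hle').trans_lt hk)
  -- `p^k c' = p^{k-a} (p^a c') = 0`
  have h2 : ((p : ℤ_[p]) ^ k) • c' = 0 := by
    rw [← Nat.cast_pow, Nat.cast_smul_eq_nsmul, ← Nat.sub_add_cancel hak.le, pow_add, mul_nsmul', ← ha,
      addOrderOf_nsmul_eq_zero, nsmul_zero]
  exact h2

/-- **`#(A ⊓ H¹(ℚ,T_pW)[p^N]) ≤ #((ι′_* red_{p^k})(A ⊓ H¹(ℚ,T_pW)[p^N]))`** for every subgroup `A ≤ H¹(ℚ, T_pW)`, `W(ℚ)` finite, `#W(ℚ)_tors < p^k`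
(the reduction is injective on these torsion classes), and the image lies in `Sel^{(p^k)}(W/ℚ) ⊓ ker (W[p^k] ↪ W)_*`.  For Kato's
`A = H¹(ℤ[1/p], T_pW)` this is the factor `#A_tors` (`N ≫ 0`) by which companion (ii) of crux M's ledger is sharpened.
[cite: Kato2004Asterisque, proof of Prop. 14.16 (2) (p. 244)] [cite: GreenbergLNM1716, appendix to §4] -/
theorem natCard_inf_torsionBy_le_natCard_map_inf [Finite W.toAffine.Point] (hk : W.torsionOrder < p ^ k)
    (A : AddSubgroup (H1 (tateRep W p) ⊤)) (N : ℕ) :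
    Nat.card ↥(A ⊓ (H1 (tateRep W p) ⊤)[((p ^ N : ℕ) : ℤ)]) ≤
        Nat.card ↥((A ⊓ (H1 (tateRep W p) ⊤)[((p ^ N : ℕ) : ℤ)]).map
          (((galoisCohomology.map (W.torsionInclusion (intPow_dvd_natCast_pow p k)) 1).comp
              (ofTopSubgroup (W.torsionGaloisModule ((p : ℤ) ^ k)).toTopRep 1).hom.toLinearMap.toAddMonoidHom).comp
            (reduceH1Pk W p k ⊤))) ∧
      (A ⊓ (H1 (tateRep W p) ⊤)[((p ^ N : ℕ) : ℤ)]).map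
          (((galoisCohomology.map (W.torsionInclusion (intPow_dvd_natCast_pow p k)) 1).comp
              (ofTopSubgroup (W.torsionGaloisModule ((p : ℤ) ^ k)).toTopRep 1).hom.toLinearMap.toAddMonoidHom).comp
            (reduceH1Pk W p k ⊤)) ≤
        selmerGroup W ((p ^ k : ℕ) : ℤ) ⊓ (torsionH1ToH1 W ((p ^ k : ℕ) : ℤ)).ker := by
  set f := (((galoisCohomology.map (W.torsionInclusion (intPow_dvd_natCast_pow p k)) 1).comp
      (ofTopSubgroup (W.torsionGaloisModule ((p : ℤ) ^ k)).toTopRep 1).hom.toLinearMap.toAddMonoidHom).comp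
    (reduceH1Pk W p k ⊤)) with hf
  have hfap : ∀ c, f c = galoisCohomology.map (W.torsionInclusion (intPow_dvd_natCast_pow p k)) 1
      ((ofTopSubgroup (W.torsionGaloisModule ((p : ℤ) ^ k)).toTopRep 1).hom (reduceH1Pk W p k ⊤ c)) := fun c => rfl
  have hmemN : ∀ c : ↥(A ⊓ (H1 (tateRep W p) ⊤)[((p ^ N : ℕ) : ℤ)]), ((p ^ N : ℕ) : ℤ) • (c : H1 (tateRep W p) ⊤) = 0 :=
    fun c => (Submodule.mem_torsionBy_iff _ _).mp c.2.2
  refine ⟨?_, ?_⟩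
  · haveI := finite_inf_torsionBy W (p := p) A N
    haveI : Finite ↥((A ⊓ (H1 (tateRep W p) ⊤)[((p ^ N : ℕ) : ℤ)]).map f) :=
      Finite.of_surjective (fun c : ↥(A ⊓ (H1 (tateRep W p) ⊤)[((p ^ N : ℕ) : ℤ)]) =>
        (⟨f c, ⟨c, c.2, rfl⟩⟩ : ↥((A ⊓ (H1 (tateRep W p) ⊤)[((p ^ N : ℕ) : ℤ)]).map f)))
        (by rintro ⟨_, c, hc, rfl⟩; exact ⟨⟨c, hc⟩, rfl⟩)
    refine Nat.card_le_card_of_injective (fun c => (⟨f c, ⟨c, c.2, rfl⟩⟩ : ↥((A ⊓ (H1 (tateRep W p) ⊤)[((p ^ N : ℕ) : ℤ)]).map f)))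
      fun c₁ c₂ h => ?_
    have h' : f (c₁ : H1 (tateRep W p) ⊤) = f c₂ := congrArg Subtype.val h
    have hsub : f ((c₁ : H1 (tateRep W p) ⊤) - c₂) = 0 := by rw [map_sub, h', sub_self]
    rw [hfap] at hsub
    have hN12 : ((p ^ N : ℕ) : ℤ) • ((c₁ : H1 (tateRep W p) ⊤) - c₂) = 0 := by rw [smul_sub, hmemN c₁, hmemN c₂, sub_self]
    exact Subtype.ext (sub_eq_zero.mp (eq_zero_of_map_torsionInclusion_reduceH1Pk_eq_zero W k hk N _ hN12 hsub))
  · rintro _ ⟨c, hc, rfl⟩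
    rw [hfap]
    exact map_torsionInclusion_reduceH1Pk_mem_selmerGroup_inf_ker W k N c
      (pow_smul_eq_zero_of_natCast_zsmul_eq_zero W N c ((Submodule.mem_torsionBy_iff _ _).mp hc.2))

end Kummer

end Summit.BirchSwinnertonDyer.BirchSwinnertonDyer.Theorems.H1TateTorsion

end
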